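import Mathlib
import Literature.RepresentationTheory.FiniteGroups.KLRGradedCellularBasis

/-!
# `SnSubsetDichotomy.NoThresholdSubsetTriple`, line `klr-graded-polynomial-method`:
# the sub-goal `two_mul_tableauDegreeStep_eq`

Infrastructure for the open stub `stub_degreeTailSingle` of crux `stmt-MatrixMultiplication-8302`:
the Brundan–Kleshchev–Wang degree increment at `p = 2` as a signed corner sum.  For a standard
Young tableau `T : StdFilling n μ.youngDiagram` and an entry `k`, let `P = prefixCells T.1 k` be
the shape of the entries `≤ k`, `A = T.1 k = (r, c)` the cell of `k` (a removable node of `P`),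
`π(B) = (-1)^{row B + col B}` and `content B = col B - row B`.  Then

`2 · tableauDegreeStep 2 T.1 k = 1 + π(A) · (Σ_{B addable in P, content B < content A} π(B)
                                          − Σ_{B removable in P, content B < content A} π(B))`.

Proof.  `P` is a finite lower set, i.e. a Young diagram `Y` (`isLowerSet_prefixCells`), and `A` is
a removable node of it (`isRemovableNode_prefixCells`); everything else is a statement about a
Young diagram `Y` with row lengths `ℓ = Y.rowLen` and a removable node `A = (r, c)`
(`ℓ r = c + 1`, `ℓ (r+1) ≤ c`):
* addable nodes are the cells `(i, ℓ i)` with `i = 0 ∨ ℓ i < ℓ (i-1)`, removable nodes the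
  cells `(i, ℓ i - 1)` with `ℓ (i+1) < ℓ i` (`isAddableNode_iff`, `isRemovableNode_iff`);
* LOCALISATION: for such corners `B`, `r < row B ⟺ content B < content A` (antitonicity of `ℓ`;
  `lt_row_iff_of_mem_addableNodes`, `lt_row_iff_of_mem_removableNodes`);
* COUNT: below row `r` there is exactly one more addable than removable node — the removable
  node of a row `i > r` corresponds to the addable node of the row `i + 1`, and the row `r + 1`
  carries the extra addable node `(r+1, ℓ (r+1))` (`card_addable_below`);
* PARITY: `cellResidue 2 B = cellResidue 2 A ⟺ π(A) π(B) = 1` (`neg_one_pow_mul_eq_ite`), so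
  `π(A) · Σ_S π = #S_same − #S_diff` for each of the two corner sets `S`, and the count
  identity turns `#S` into the degree step (`two_mul_step`).
-/

namespace Summit.MatrixMultiplication.MatrixMultiplication.Theorems

open Literature.RepresentationTheory.FiniteGroups
open Literature.NumberTheory.DiophantineGeometry (StdFilling)

namespace TwoMulTableauDegreeStep

/-! ### Addable and removable nodes of a Young diagram via row lengths -/

set_option linter.dupNamespace false in -- deliberate Summit.<S>.<P> duplicate
/-- The addable nodes of a Young diagram are the cells `(i, ℓ i)` at the end of a row that is
strictly shorter than the previous one (or is row `0`), `ℓ = rowLen`. [folklore] -/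
theorem isAddableNode_iff (Y : YoungDiagram) (i j : ℕ) :
    IsAddableNode Y.cells (i, j) ↔
      j = Y.rowLen i ∧ (i = 0 ∨ Y.rowLen i < Y.rowLen (i - 1)) := by
  simp only [IsAddableNode, YoungDiagram.mem_cells, YoungDiagram.mem_iff_lt_rowLen]
  omega

set_option linter.dupNamespace false in -- deliberate Summit.<S>.<P> duplicate
/-- The removable nodes of a Young diagram are the last cells `(i, ℓ i - 1)` of the rows that are
strictly longer than the next one, `ℓ = rowLen`. [folklore] -/
theorem isRemovableNode_iff (Y : YoungDiagram) (i j : ℕ) :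
    IsRemovableNode Y.cells (i, j) ↔ j + 1 = Y.rowLen i ∧ Y.rowLen (i + 1) ≤ j := by
  simp only [IsRemovableNode, YoungDiagram.mem_cells, YoungDiagram.mem_iff_lt_rowLen]
  omega

/-! ### Localisation: below the removable node `A` means content below the content of `A` -/

set_option linter.dupNamespace false in -- deliberate Summit.<S>.<P> duplicate
/-- For an addable node `B` of a Young diagram with a removable node `A`: `B` lies strictly below
the row of `A` iff `content B < content A` (`content = col - row`). [folklore] -/
theorem lt_row_iff_of_mem_addableNodes (Y : YoungDiagram) {A B : ℕ × ℕ}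
    (hA : IsRemovableNode Y.cells A) (hB : B ∈ addableNodes Y.cells) :
    A.1 < B.1 ↔ (B.2 : ℤ) - B.1 < (A.2 : ℤ) - A.1 := by
  obtain ⟨r, c⟩ := A
  obtain ⟨i, j⟩ := B
  rw [mem_addableNodes, isAddableNode_iff] at hB
  rw [isRemovableNode_iff] at hA
  obtain ⟨rfl, -⟩ := hB
  dsimp only
  constructor
  · intro h
    have := Y.rowLen_anti (r + 1) i h
    omega
  · intro h
    by_contra hle
    have := Y.rowLen_anti i r (not_lt.1 hle)
    omega

set_option linter.dupNamespace false in -- deliberate Summit.<S>.<P> duplicate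
/-- For a removable node `B` of a Young diagram with a removable node `A`: `B` lies strictly
below the row of `A` iff `content B < content A` (`content = col - row`). [folklore] -/
theorem lt_row_iff_of_mem_removableNodes (Y : YoungDiagram) {A B : ℕ × ℕ}
    (hA : IsRemovableNode Y.cells A) (hB : B ∈ removableNodes Y.cells) :
    A.1 < B.1 ↔ (B.2 : ℤ) - B.1 < (A.2 : ℤ) - A.1 := by
  obtain ⟨r, c⟩ := A
  obtain ⟨i, j⟩ := B
  rw [mem_removableNodes, isRemovableNode_iff] at hB
  rw [isRemovableNode_iff] at hA
  dsimp only
  constructor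
  · intro h
    have := Y.rowLen_anti (r + 1) i h
    omega
  · intro h
    by_contra hle
    have := Y.rowLen_anti i r (not_lt.1 hle)
    omega

/-! ### Count: one more addable than removable node below a removable node -/

set_option linter.dupNamespace false in -- deliberate Summit.<S>.<P> duplicate
/-- Below the row of a removable node `A` of a Young diagram there is exactly one more addable
node than there are removable nodes: the removable node of a row `i > row A` corresponds to the
addable node of the row `i + 1`, and the row `row A + 1` carries the extra addable node.
[folklore] -/
theorem card_addable_below (Y : YoungDiagram) {A : ℕ × ℕ} (hA : IsRemovableNode Y.cells A) :
    ((addableNodes Y.cells).filter fun B => A.1 < B.1).card =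
      ((removableNodes Y.cells).filter fun B => A.1 < B.1).card + 1 := by
  obtain ⟨r, c⟩ := A
  rw [isRemovableNode_iff] at hA
  dsimp only
  rw [← Finset.card_filter_add_card_filter_not
    (s := (addableNodes Y.cells).filter fun B => r < B.1) (fun B : ℕ × ℕ => B.1 = r + 1)]
  have h1 : (((addableNodes Y.cells).filter fun B => r < B.1).filter
      fun B : ℕ × ℕ => B.1 = r + 1) = {(r + 1, Y.rowLen (r + 1))} := by
    ext ⟨i, j⟩
    simp only [Finset.mem_filter, mem_addableNodes, isAddableNode_iff, Finset.mem_singleton,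
      Prod.mk.injEq]
    constructor
    · rintro ⟨⟨⟨rfl, -⟩, -⟩, rfl⟩
      exact ⟨rfl, rfl⟩
    · rintro ⟨rfl, rfl⟩
      refine ⟨⟨⟨rfl, Or.inr ?_⟩, Nat.lt_succ_self r⟩, rfl⟩
      rw [Nat.add_sub_cancel]
      omega
  rw [h1, Finset.card_singleton, add_comm]
  congr 1
  refine Finset.card_bij' (fun B _ => (B.1 - 1, Y.rowLen (B.1 - 1) - 1))
    (fun B _ => (B.1 + 1, Y.rowLen (B.1 + 1))) ?_ ?_ ?_ ?_
  · rintro ⟨i, j⟩ hB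
    simp only [Finset.mem_filter, mem_addableNodes, isAddableNode_iff, mem_removableNodes,
      isRemovableNode_iff] at hB ⊢
    obtain ⟨⟨⟨rfl, h⟩, hri⟩, hne⟩ := hB
    obtain ⟨i, rfl⟩ : ∃ i', i = i' + 1 := ⟨i - 1, by omega⟩
    simp only [Nat.add_sub_cancel] at h ⊢
    omega
  · rintro ⟨i, j⟩ hB
    simp only [Finset.mem_filter, mem_addableNodes, isAddableNode_iff, mem_removableNodes,
      isRemovableNode_iff] at hB ⊢
    simp only [Nat.add_sub_cancel, true_and]
    omega
  · rintro ⟨i, j⟩ hB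
    simp only [Finset.mem_filter, mem_addableNodes, isAddableNode_iff] at hB
    obtain ⟨⟨⟨rfl, -⟩, hri⟩, -⟩ := hB
    obtain ⟨i, rfl⟩ : ∃ i', i = i' + 1 := ⟨i - 1, by omega⟩
    simp only [Nat.add_sub_cancel]
  · rintro ⟨i, j⟩ hB
    simp only [Finset.mem_filter, mem_removableNodes, isRemovableNode_iff] at hB
    simp only [Nat.add_sub_cancel, Prod.mk.injEq, true_and]
    omega

/-! ### Parity: residues mod `2` and the signs `π` -/

set_option linter.dupNamespace false in -- deliberate Summit.<S>.<P> duplicate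
/-- `cellResidue 2 B = cellResidue 2 A` iff `row + col` has the same parity at `A` and `B`, i.e.
iff `π(A) π(B) = 1`, `π(x) = (-1)^{row x + col x}`. [folklore] -/
theorem neg_one_pow_mul_eq_ite (A B : ℕ × ℕ) :
    (-1 : ℤ) ^ (A.1 + A.2) * (-1) ^ (B.1 + B.2) =
      if cellResidue 2 B = cellResidue 2 A then 1 else -1 := by
  have key : cellResidue 2 B = cellResidue 2 A ↔ (A.1 + A.2 + (B.1 + B.2)) % 2 = 0 := by
    unfold cellResidue
    rw [sub_eq_sub_iff_add_eq_add]
    norm_cast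
    rw [ZMod.natCast_eq_natCast_iff']
    omega
  rw [← pow_add, neg_one_pow_eq_pow_mod_two]
  split_ifs with h
  · rw [key.1 h, pow_zero]
  · rw [key.not.1 h |> fun h' => (Nat.mod_two_ne_zero.1 h'), pow_one]

set_option linter.dupNamespace false in -- deliberate Summit.<S>.<P> duplicate
/-- `π(A) · Σ_{B ∈ S} π(B) = #{B ∈ S : res₂ B = res₂ A} − #{B ∈ S : res₂ B ≠ res₂ A}`.
[folklore] -/
theorem neg_one_pow_mul_sum (A : ℕ × ℕ) (S : Finset (ℕ × ℕ)) :
    (-1 : ℤ) ^ (A.1 + A.2) * S.sum (fun B => (-1 : ℤ) ^ (B.1 + B.2)) =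
      ((S.filter fun B => cellResidue 2 B = cellResidue 2 A).card : ℤ) -
        ((S.filter fun B => ¬ cellResidue 2 B = cellResidue 2 A).card : ℤ) := by
  rw [Finset.mul_sum, Finset.sum_congr rfl fun B _ => neg_one_pow_mul_eq_ite A B, Finset.sum_ite,
    Finset.sum_const, Finset.sum_const]
  simp only [nsmul_eq_mul, mul_one, mul_neg, sub_eq_add_neg]

/-! ### The identity for a Young diagram with a removable node -/

set_option linter.dupNamespace false in -- deliberate Summit.<S>.<P> duplicate
/-- **The degree step as a signed corner sum**, abstract form: for a Young diagram `Y` and a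
removable node `A` of `Y`, twice the Brundan–Kleshchev–Wang count `#{addable B : res₂ B = res₂ A,
row B > row A} − #{removable B : res₂ B = res₂ A, row B > row A}` equals
`1 + π(A) · (Σ_{addable B, content B < content A} π(B) − Σ_{removable B, …} π(B))`.
[folklore] -/
theorem two_mul_step (Y : YoungDiagram) {A : ℕ × ℕ} (hA : IsRemovableNode Y.cells A) :
    2 * ((((addableNodes Y.cells).filter fun B =>
            cellResidue 2 B = cellResidue 2 A ∧ A.1 < B.1).card : ℤ) -
          (((removableNodes Y.cells).filter fun B =>
            cellResidue 2 B = cellResidue 2 A ∧ A.1 < B.1).card : ℤ)) =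
      1 + (-1 : ℤ) ^ (A.1 + A.2) *
        (((addableNodes Y.cells).filter (fun B => (B.2 : ℤ) - B.1 < (A.2 : ℤ) - A.1)).sum
            (fun B => (-1 : ℤ) ^ (B.1 + B.2)) -
          ((removableNodes Y.cells).filter (fun B => (B.2 : ℤ) - B.1 < (A.2 : ℤ) - A.1)).sum
            (fun B => (-1 : ℤ) ^ (B.1 + B.2))) := by
  -- localisation: rewrite the row condition as the content condition
  have hfa : ((addableNodes Y.cells).filter
        fun B => cellResidue 2 B = cellResidue 2 A ∧ A.1 < B.1) =
      ((addableNodes Y.cells).filter (fun B => (B.2 : ℤ) - B.1 < (A.2 : ℤ) - A.1)).filter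
        fun B => cellResidue 2 B = cellResidue 2 A := by
    rw [Finset.filter_filter]
    refine Finset.filter_congr fun B hB => ?_
    rw [lt_row_iff_of_mem_addableNodes Y hA hB, and_comm]
  have hfr : ((removableNodes Y.cells).filter
        fun B => cellResidue 2 B = cellResidue 2 A ∧ A.1 < B.1) =
      ((removableNodes Y.cells).filter (fun B => (B.2 : ℤ) - B.1 < (A.2 : ℤ) - A.1)).filter
        fun B => cellResidue 2 B = cellResidue 2 A := by
    rw [Finset.filter_filter]
    refine Finset.filter_congr fun B hB => ?_
    rw [lt_row_iff_of_mem_removableNodes Y hA hB, and_comm]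
  have hca : ((addableNodes Y.cells).filter (fun B => (B.2 : ℤ) - B.1 < (A.2 : ℤ) - A.1)) =
      (addableNodes Y.cells).filter fun B => A.1 < B.1 :=
    Finset.filter_congr fun B hB => (lt_row_iff_of_mem_addableNodes Y hA hB).symm
  have hcr : ((removableNodes Y.cells).filter (fun B => (B.2 : ℤ) - B.1 < (A.2 : ℤ) - A.1)) =
      (removableNodes Y.cells).filter fun B => A.1 < B.1 :=
    Finset.filter_congr fun B hB => (lt_row_iff_of_mem_removableNodes Y hA hB).symm
  have hcount := card_addable_below Y hA
  rw [← hca, ← hcr] at hcount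
  set Sa := (addableNodes Y.cells).filter (fun B => (B.2 : ℤ) - B.1 < (A.2 : ℤ) - A.1)
  set Sr := (removableNodes Y.cells).filter (fun B => (B.2 : ℤ) - B.1 < (A.2 : ℤ) - A.1)
  rw [hfa, hfr, mul_sub ((-1 : ℤ) ^ (A.1 + A.2)), neg_one_pow_mul_sum, neg_one_pow_mul_sum]
  have h1 := Finset.card_filter_add_card_filter_not (s := Sa)
    (fun B => cellResidue 2 B = cellResidue 2 A)
  have h2 := Finset.card_filter_add_card_filter_not (s := Sr)
    (fun B => cellResidue 2 B = cellResidue 2 A)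
  omega

end TwoMulTableauDegreeStep

open TwoMulTableauDegreeStep

/-! ### Prefixes of standard tableaux -/

set_option linter.dupNamespace false in -- deliberate Summit.<S>.<P> duplicate
/-- The shape `prefixCells T.1 k` of the entries `≤ k` of a standard Young tableau of shape
`μ ⊢ n` is a lower set: a cell weakly north-west of the cell of an entry `j ≤ k` is a cell of
`μ` (Young diagrams are lower sets), hence carries an entry, which is `≤ j` by standardness.
[folklore] -/
theorem isLowerSet_prefixCells {n : ℕ} {μ : Nat.Partition n}
    (T : StdFilling n μ.youngDiagram) (k : Fin n) :
    IsLowerSet ((prefixCells T.1 k : Finset (ℕ × ℕ)) : Set (ℕ × ℕ)) := by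
  intro x y hyx hx
  rw [Finset.mem_coe, prefixCells, Finset.mem_image] at hx ⊢
  obtain ⟨j, hj, rfl⟩ := hx
  rw [Finset.mem_filter] at hj
  have hy : y ∈ μ.youngDiagram := μ.youngDiagram.isLowerSet hyx (T.mem j)
  obtain ⟨j', hj'⟩ := T.exists_eq μ.card_cells_youngDiagram hy
  refine ⟨j', Finset.mem_filter.2 ⟨Finset.mem_univ _, ?_⟩, hj'⟩
  by_contra hlt
  have hjj' : j < j' := lt_of_le_of_lt hj.2 (not_le.1 hlt)
  exact T.not_le hjj' (by rw [hj']; exact hyx)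

set_option linter.dupNamespace false in -- deliberate Summit.<S>.<P> duplicate
/-- The cell `T.1 k` of the entry `k` is a removable node of the shape `prefixCells T.1 k` of the
entries `≤ k`: no entry `j ≤ k` lies strictly south-east of it. [folklore] -/
theorem isRemovableNode_prefixCells {n : ℕ} {Y : YoungDiagram} (T : StdFilling n Y) (k : Fin n) :
    IsRemovableNode (prefixCells T.1 k) (T.1 k) := by
  have key : ∀ x ∈ prefixCells T.1 k, ¬ (T.1 k < x) := by
    intro x hx hlt
    rw [prefixCells, Finset.mem_image] at hx
    obtain ⟨j, hj, rfl⟩ := hx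
    rw [Finset.mem_filter] at hj
    rcases hj.2.lt_or_eq with h | h
    · exact T.not_le h hlt.le
    · rw [h] at hlt
      exact lt_irrefl _ hlt
  refine ⟨?_, fun h => key _ h ?_, fun h => key _ h ?_⟩
  · exact Finset.mem_image.2 ⟨k, Finset.mem_filter.2 ⟨Finset.mem_univ _, le_rfl⟩, rfl⟩
  · exact Prod.lt_iff.2 (Or.inl ⟨Nat.lt_succ_self _, le_rfl⟩)
  · exact Prod.lt_iff.2 (Or.inr ⟨le_rfl, Nat.lt_succ_self _⟩)

set_option linter.dupNamespace false in -- deliberate Summit.<S>.<P> duplicate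
/-- **The Brundan–Kleshchev–Wang degree step at `p = 2` as a signed corner sum** (sub-goal
`two_mul_tableauDegreeStep_eq` of line `klr-graded-polynomial-method`, crux
`SnSubsetDichotomy.NoThresholdSubsetTriple`).  For a standard Young tableau `T` of shape `μ ⊢ n`
and an entry `k` with cell `A = T.1 k`, `P = prefixCells T.1 k` the shape of the entries `≤ k`,
`π(B) = (-1)^{row B + col B}`, `content B = col B − row B`:
`2 · d_A(P) = 1 + π(A) · (Σ_{B addable in P, content B < content A} π(B) −
Σ_{B removable in P, content B < content A} π(B))`, where
`d_A(P) = tableauDegreeStep 2 T.1 k` counts the addable minus the removable nodes of `P` strictly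
below `A` of the `2`-residue of `A`.  (Localisation `row B > row A ⟺ content B < content A` for
corners, one more addable than removable corner below `A`, and
`res₂ B = res₂ A ⟺ π(B) = π(A)`.) [folklore] -/
theorem two_mul_tableauDegreeStep_eq : ∀ (n : ℕ) (μ : Nat.Partition n) (T : Literature.NumberTheory.DiophantineGeometry.StdFilling n μ.youngDiagram) (k : Fin n), 2 * Literature.RepresentationTheory.FiniteGroups.tableauDegreeStep 2 T.1 k = 1 + (-1 : ℤ) ^ ((T.1 k).1 + (T.1 k).2) * (((Literature.RepresentationTheory.FiniteGroups.addableNodes (Literature.RepresentationTheory.FiniteGroups.prefixCells T.1 k)).filter (fun B => (B.2 : ℤ) - B.1 < ((T.1 k).2 : ℤ) - (T.1 k).1)).sum (fun B => (-1 : ℤ) ^ (B.1 + B.2)) - ((Literature.RepresentationTheory.FiniteGroups.removableNodes (Literature.RepresentationTheory.FiniteGroups.prefixCells T.1 k)).filter (fun B => (B.2 : ℤ) - B.1 < ((T.1 k).2 : ℤ) - (T.1 k).1)).sum (fun B => (-1 : ℤ) ^ (B.1 + B.2))) := by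
  intro n μ T k
  exact two_mul_step ⟨prefixCells T.1 k, isLowerSet_prefixCells T k⟩
    (isRemovableNode_prefixCells T k)

end Summit.MatrixMultiplication.MatrixMultiplication.Theorems
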